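import Summits.BirchSwinnertonDyer.BirchSwinnertonDyer.Theorems.EisensteinPrimesHidaLimitFittingBound
import Summits.BirchSwinnertonDyer.Rank1Residual.X11b.CongruenceLimitOneSided
import Summits.BirchSwinnertonDyer.Rank1Residual.X11b.BDPRouteOpenInputDegenerateFrame
import Summits.BirchSwinnertonDyer.Rank1Residual.X11b.AnticyclotomicModuleFinite
import Summits.BirchSwinnertonDyer.Rank1Residual.X2.HidaLimitCongruenceAlgebra
import Literature.NumberTheory.EllipticCurves.IwasawaAlgebraCharIdealProofs
import Mathlib.RingTheory.PowerSeries.Ideal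
import HarnessLib

/-!
# Route `ErratumRoadFive`, crux `IMCDivAtErratumDataAll` (item stmt-BirchSwinnertonDyer-19270): the
# one-sided congruence transfer on `X_ac^Σ(E[p^∞])` WITHOUT erratum Lemma 2.2 — torsion alone suffices
# (the `𝔪^k`-trick of PROOF-BDP Thm. B′ (3), both generators `p` AND `T`, in the kernel)

Cell `bsd-stepL` (run/shared/lean/pub/bsd-stepL/), PART 1b ACCEL seat `bsd-stepL-imc24c` (prover, row (3));
`--supports stmt-BirchSwinnertonDyer-19270 --as helper`; third file of the seat after
`Theorems/ErratumRoadFiveIMCDivOneSidedCongruenceDefs.lean` (the glue; its package carries the input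
`hnf` = "no nonzero finite submodule of `X^Σ_ac(E[p^∞])`" = erratum Lemma 2.2) and
`…CongruenceCoefficientDescent.lean`. HONEST FRAMING: THEOREMS ONLY (pure commutative algebra + one
theorem on the constructed module); no definition, no named fact, no `sorry`; nothing is asserted
about any curve; the item is NOT closed; BSD is proved for no pair; X11b stays CONSTRUCTION-SHAPED.

## Why (lit g14 ROADFF SOURCE PACK §20.0 (3), 2026-08-26)

Every one-sided congruence file of the tree needs, on the FIXED module `X = X^Σ_ac(E[p^∞])`, torsion
[CTL, Cas18 Thm. 2.3 — refereed, and a cell THEOREM at erratum data for `Σ = ∅`] AND `hnf` (no nonzero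
finite submodule) to turn `Fitt_Λ(X)·Λ^{ur} ⊆ (L)` into `Ch_Λ(X)·Λ^{ur} ⊆ (L)` via `Fitt_Λ = Ch_Λ`. The
erratum's warrant for `hnf` is Lemma 2.2 "details in [HL19, Lem. 3.12]" — but Hatley–Lei stands under
`N̄⁻ = 1`, `(D_K, N̄p) = 1`, which EXCLUDES the erratum's ramified `q` (lit g14); only Greenberg 2016's
abstract Prop. 4.1.1 remains behind it. PROOF-BDP Thm. B′ step (3) observed that `hnf` is not needed:
`Fitt₀(X) ⊇ Fitt₀(X_fin)·Ch(X)` with `Fitt₀(X_fin) ⊇ 𝔪^k`, and in the UFD `R₀⟦T⟧` "`𝔪^k·c ⊆ (ℓ) ⇒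
c ∈ (ℓ)`" because `ℓ/gcd(ℓ,c)` would divide both `p^k` and `T^k`. Cell bsd-eis kernel-proved the
`p`-half (`Theorems.exists_span_C_pow_mul_span_le_fittingIdeal_zero`: `(p)^a·Ch(X) ⊆ Fitt₀(X)` for
f.g. torsion `X`), which alone needs `μ(L) = 0` downstream. THIS FILE adds the `T`-half and the
two-prime cancellation, so that NEITHER `hnf` NOR `μ = 0` is needed: on the one-sided road the fixed
module's input shrinks to "`X^Σ_ac(E[p^∞])` is `Λ`-torsion".

## Contents

* §1 (algebra) `exists_X_pow_smul_eq_zero_of_finite` (a finite module over `A⟦T⟧` is killed by a power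
  of `T`: pigeonhole on `T^k z` + `1 − T^d` is a unit); `exists_pow_mem_fittingIdeal_zero_of_forall_smul_eq_zero`
  (`x·N = 0`, `N` with `g` generators ⟹ `x^g ∈ Fitt₀(N)`); **`exists_span_X_pow_mul_span_le_fittingIdeal_zero`**
  (f.g. torsion `Λ`-module `X`, `Ch(X) = (F)` ⟹ `∃ b, (T)^b·(F) ⊆ Fitt₀(X)` — the `T`-twin of bsd-eis's
  `p`-lemma, same maximal-finite-submodule proof); **`dvd_of_dvd_prime_pow_mul_of_dvd_prime_pow_mul`**
  (UFD: `π₁` prime, `π₁ ∤ π₂`, `ℓ ∣ π₁^a c`, `ℓ ∣ π₂^b c` ⟹ `ℓ ∣ c`).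
* §2 **`AcSelmer.XAc.charIdeal_map_toUnr_le_span_of_oneSided_congruences_of_isTorsion`** — the glue
  file's §1 ∘ §2 with `hnf` DELETED: `Σ` finite, `X^Σ` torsion, members `N_m` with `Λ`-isomorphisms
  `X^Σ/p^m ≅ N_m/p^m`, printed member inclusions, (c), one-sided `Σ`-removal data (`P_Σ ≠ 0`,
  `Ch(X^∅)·(P_Σ) ⊆ Ch(X^Σ)`, `(L^Σ) = (L·P_Σ)`) ⟹ **`Ch_Λ(X_ac^∅)·R₀⟦T⟧ ⊆ (L)`** — the input `hdiv` of
  the glue file's §3 `P2.exists_intCoreFrame_of_unrFrame_of_charIdeal_map_le`. (`R₀` is a DVR, so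
  `R₀⟦T⟧` is a UFD; `p` and `T` are non-associated primes there.)

References: [Castella2018Erratum] Lemma 2.2 and proof of Thm. 1.1 (p. 4); [HatleyLei2019] MRL 26,
Lem. 3.12 (scope); [Greenberg2016] Prop. 4.1.1; cell memo `proof/PROOF-BDP.md` §13.2 Thm. B′ (3);
[Skinner2016PacificMC] §3.1; [Washington1997] §13.2; [StacksProject] 07ZA; [Eisenbud1995] §20.2.
-/

set_option autoImplicit false

noncomputable section

open scoped Classical

open PowerSeries Literature.NumberTheory.EllipticCurves Literature.NumberTheory.EllipticCurves.Module
  Literature.RingTheory.FittingIdeal NumberField IsDedekindDomain Field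
open Summit.BirchSwinnertonDyer.Rank1Residual.X11b.AcSelmer Summit.BirchSwinnertonDyer.Rank1Residual.X11b.Halves
  Summit.BirchSwinnertonDyer.Rank1Residual.X2
open Summit.BirchSwinnertonDyer.BirchSwinnertonDyer.Theorems (exists_finite_submodule_forall_finite_eq_bot
  charIdeal_eq_top_of_finite fittingIdeal_zero_mul_quotient_le isTorsion_quotient
  exists_span_C_pow_mul_span_le_fittingIdeal_zero)

namespace Summit.BirchSwinnertonDyer.Rank1Residual.X11b

/-! ### §1 Algebra: the `T`-half of the `𝔪^k`-trick and the two-prime cancellation -/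

namespace CongruenceDescent

/-- **A finite module over a power series ring is killed by a power of the variable.** For `z ∈ N`
the sequence `T^k z` takes finitely many values, so `T^i z = T^{i+d+1} z` for some `d`; as `1 − T^{d+1}`
is a unit of `A⟦T⟧`, `T^i z = 0`; a uniform exponent exists since `N` is finite. [folklore] -/
theorem exists_X_pow_smul_eq_zero_of_finite {A : Type*} [CommRing A] (N : Type*) [AddCommGroup N]
    [Module (PowerSeries A) N] [Finite N] :
    ∃ k : ℕ, ∀ z : N, (X : PowerSeries A) ^ k • z = 0 := by
  have hz : ∀ z : N, ∃ k : ℕ, (X : PowerSeries A) ^ k • z = 0 := by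
    intro z
    obtain ⟨i, j, hij, hEq⟩ :=
      Finite.exists_ne_map_eq_of_infinite (fun k : ℕ ↦ (X : PowerSeries A) ^ k • z)
    wlog hlt : i < j generalizing i j
    · exact this j i hij.symm hEq.symm (lt_of_le_of_ne (not_lt.mp hlt) hij.symm)
    obtain ⟨d, rfl⟩ := Nat.exists_eq_add_of_lt hlt
    refine ⟨i, ?_⟩
    have hu : IsUnit ((1 : PowerSeries A) - X ^ (d + 1)) := by
      rw [PowerSeries.isUnit_iff_constantCoeff]
      simp
    have h0 : ((1 : PowerSeries A) - X ^ (d + 1)) • ((X : PowerSeries A) ^ i • z) = 0 := by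
      rw [sub_smul, one_smul, sub_eq_zero, ← mul_smul, ← pow_add,
        show d + 1 + i = i + d + 1 by omega]
      exact hEq
    obtain ⟨u, hu'⟩ := hu
    have h1 := congrArg (fun w : N ↦ ((↑u⁻¹ : PowerSeries A)) • w) h0
    simp only [smul_zero] at h1
    rwa [← hu', ← mul_smul, Units.inv_mul, one_smul] at h1
  choose k hk using hz
  haveI := Fintype.ofFinite N
  refine ⟨Finset.univ.sup k, fun z ↦ ?_⟩
  have hle : k z ≤ Finset.univ.sup k := Finset.le_sup (Finset.mem_univ z)
  rw [← Nat.sub_add_cancel hle, pow_add, mul_smul, hk z, smul_zero]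

/-- **`x^g ∈ Fitt₀(N)` when `x` kills a module `N` with `g` generators** (diagonal relations
`x·xᵢ = 0`, determinant `x^g`). [cite: Eisenbud1995, §20.2] -/
theorem exists_pow_mem_fittingIdeal_zero_of_forall_smul_eq_zero {R : Type*} [CommRing R]
    (N : Type*) [AddCommGroup N] [Module R N] [Module.Finite R N] (x : R) (hx : ∀ z : N, x • z = 0) :
    ∃ g : ℕ, x ^ g ∈ Module.fittingIdeal R N 0 := by
  obtain ⟨g, y, hy⟩ := Module.Finite.exists_fin (R := R) (M := N)
  refine ⟨g, ?_⟩
  let ρ : Fin g → Fin (g + 0) → R := fun i l => Matrix.diagonal (fun _ : Fin g => x) i l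
  have hρ : ∀ i, ∑ l, ρ i l • y l = 0 := fun i => by
    simp only [ρ, Matrix.diagonal_apply, ite_smul, zero_smul, Finset.sum_ite_eq, Finset.mem_univ,
      if_true]
    exact hx (y i)
  have hmem := Module.det_mem_fittingIdeal (k := 0) (j := g) y hy ρ hρ (Function.Embedding.refl _)
  have hM : (Matrix.of fun i i' => ρ i ((Function.Embedding.refl (Fin g)) i')) =
      Matrix.diagonal (fun _ : Fin g => x) := by
    ext i j
    rfl
  rw [hM, Matrix.det_diagonal, Finset.prod_const, Finset.card_univ, Fintype.card_fin] at hmem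
  exact hmem

variable {p : ℕ} [Fact p.Prime]

/-- **The `T`-half of the finite-submodule bound** (twin of bsd-eis's
`Theorems.exists_span_C_pow_mul_span_le_fittingIdeal_zero`): for a finitely generated TORSION
`Λ = ℤ_p⟦T⟧`-module `X` with `Ch(X) = (F)` there is `b` with `(T)^b·(F) ⊆ Fitt₀(X)`. Same proof: the
maximal finite submodule `N` (`X/N` without finite submodules, so `Ch(X) = Ch(X/N) = Fitt₀(X/N)`), a
power of `T` in `Fitt₀(N)` (§1), and `Fitt₀(N)·Fitt₀(X/N) ⊆ Fitt₀(X)`.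
[cite: Washington1997, §13.2] [cite: SkinnerUrban2014, §3.1.6 (p. 20)] [cite: Eisenbud1995, §20.2] -/
theorem exists_span_X_pow_mul_span_le_fittingIdeal_zero (X' : Type*) [AddCommGroup X']
    [Module (IwasawaAlgebra p) X'] [Module.Finite (IwasawaAlgebra p) X']
    (hX : Module.IsTorsion (IwasawaAlgebra p) X') {F : IwasawaAlgebra p}
    (hF : Module.charIdeal (IwasawaAlgebra p) X' = Ideal.span {F}) :
    ∃ b : ℕ, Ideal.span {(X : IwasawaAlgebra p)} ^ b * Ideal.span {F} ≤
      Module.fittingIdeal (IwasawaAlgebra p) X' 0 := by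
  haveI : IsNoetherian (IwasawaAlgebra p) X' := isNoetherian_of_isNoetherianRing_of_finite _ _
  obtain ⟨N, hNfin, hnf⟩ :=
    exists_finite_submodule_forall_finite_eq_bot (R := IwasawaAlgebra p) (X := X')
  haveI := hNfin
  haveI : Module.Finite (IwasawaAlgebra p) N := Module.Finite.iff_fg.mpr (IsNoetherian.noetherian N)
  have hY : Module.IsTorsion (IwasawaAlgebra p) (X' ⧸ N) := isTorsion_quotient hX N
  have hcharY : Module.charIdeal (IwasawaAlgebra p) (X' ⧸ N) =
      Module.fittingIdeal (IwasawaAlgebra p) (X' ⧸ N) 0 :=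
    Summit.BirchSwinnertonDyer.Rank1Residual.X1.GeneratorBoundOrd.charIdeal_eq_fittingIdeal_zero hY hnf
  have hmul : Module.charIdeal (IwasawaAlgebra p) X' =
      Module.charIdeal (IwasawaAlgebra p) N * Module.charIdeal (IwasawaAlgebra p) (X' ⧸ N) :=
    Module.charIdeal_eq_mul_of_exact hX N.subtype N.mkQ (Submodule.injective_subtype N)
      (Submodule.mkQ_surjective N) (LinearMap.exact_subtype_mkQ N)
  rw [charIdeal_eq_top_of_finite (p := p) N, Ideal.top_mul, hcharY, hF] at hmul
  obtain ⟨k, hk⟩ := exists_X_pow_smul_eq_zero_of_finite (A := ℤ_[p]) N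
  obtain ⟨g, hg⟩ := exists_pow_mem_fittingIdeal_zero_of_forall_smul_eq_zero N
    ((X : IwasawaAlgebra p) ^ k) hk
  refine ⟨k * g, ?_⟩
  calc Ideal.span {(X : IwasawaAlgebra p)} ^ (k * g) * Ideal.span {F}
      = Ideal.span {((X : IwasawaAlgebra p) ^ k) ^ g} *
          Module.fittingIdeal (IwasawaAlgebra p) (X' ⧸ N) 0 := by
        rw [Ideal.span_singleton_pow, ← pow_mul, hmul]
    _ ≤ Module.fittingIdeal (IwasawaAlgebra p) N 0 *
          Module.fittingIdeal (IwasawaAlgebra p) (X' ⧸ N) 0 :=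
        Ideal.mul_mono_left ((Ideal.span_singleton_le_iff_mem _).2 hg)
    _ ≤ Module.fittingIdeal (IwasawaAlgebra p) X' 0 := fittingIdeal_zero_mul_quotient_le N

/-- **Two-prime cancellation in a UFD.** If `π₁` is prime, `π₁ ∤ π₂`, and `ℓ ∣ π₁^a·c`,
`ℓ ∣ π₂^b·c`, then `ℓ ∣ c` (induction on the prime factorisation of `ℓ`: a prime factor of `ℓ`
dividing `π₁` is associated with it, hence cannot divide `π₂`, so it divides `c`). With `π₁ = p`, `π₂ = T` in `R₀⟦T⟧`: "`𝔪^k·c ⊆ (ℓ) ⇒ c ∈ (ℓ)`"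
(PROOF-BDP Thm. B′ (3)). [folklore] -/
theorem dvd_of_dvd_prime_pow_mul_of_dvd_prime_pow_mul {S : Type*} [CommRing S] [IsDomain S]
    [UniqueFactorizationMonoid S] {π₁ π₂ : S} (h₁ : Prime π₁) (h12 : ¬ π₁ ∣ π₂)
    (a b : ℕ) (ℓ : S) :
    ∀ c : S, ℓ ∣ π₁ ^ a * c → ℓ ∣ π₂ ^ b * c → ℓ ∣ c := by
  refine UniqueFactorizationMonoid.induction_on_prime ℓ ?_ ?_ ?_
  · intro c hc _
    rw [zero_dvd_iff] at hc ⊢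
    exact (mul_eq_zero.mp hc).resolve_left (pow_ne_zero _ h₁.ne_zero)
  · intro u hu c _ _
    exact hu.dvd
  · intro ℓ' q hℓ' hq IH c hc1 hc2
    -- the prime `q` divides `c`
    have hqc : q ∣ c := by
      rcases hq.dvd_or_dvd ((dvd_mul_right q ℓ').trans hc1) with hq1 | hq1
      · have hqπ₁ : q ∣ π₁ := hq.dvd_of_dvd_pow hq1
        rcases hq.dvd_or_dvd ((dvd_mul_right q ℓ').trans hc2) with hq2 | hq2
        · exact absurd ((hq.associated_of_dvd h₁ hqπ₁).symm.dvd.trans (hq.dvd_of_dvd_pow hq2)) h12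
        · exact hq2
      · exact hq1
    obtain ⟨c', rfl⟩ := hqc
    rw [mul_left_comm, mul_dvd_mul_iff_left hq.ne_zero] at hc1 hc2
    exact mul_dvd_mul_left q (IH c' hc1 hc2)

/-- `R₀ = unrIntegers p`: the prime `p`. [cite: Castella2018, §3 (p. 9)] -/
theorem prime_natCast_p_unrIntegers : Prime ((p : ℕ) : unrIntegers p) := by
  haveI := HidaLimitAlgebra.isDiscreteValuationRing_unrIntegers (p := p)
  exact UniqueFactorizationMonoid.irreducible_iff_prime.mp HidaLimitAlgebra.irreducible_natCast_p

/-- In `R₀⟦T⟧`: `p ∤ T` (compare the coefficients of `T`). [folklore] -/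
theorem not_C_p_dvd_X_unrSeries :
    ¬ (C ((p : ℕ) : unrIntegers p) : UnrSeries p) ∣ (X : UnrSeries p) := by
  rintro ⟨g, hg⟩
  have h1 := congrArg (PowerSeries.coeff 1) hg
  rw [PowerSeries.coeff_one_X, PowerSeries.coeff_C_mul] at h1
  exact HidaLimitAlgebra.irreducible_natCast_p.not_isUnit (isUnit_iff_exists_inv.mpr ⟨_, h1.symm⟩)

end CongruenceDescent

/-! ### §2 On `X_ac^Σ(E[p^∞])`: the one-sided transfer from TORSION ALONE (no Lemma 2.2, no `μ = 0`) -/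

section XAc

variable {K : Type} [Field K] [NumberField K] (E : WeierstrassCurve K) [E.IsElliptic]
  (p : ℕ) [Fact p.Prime] (κ : ZpExtension K p) (𝔭 : HeightOneSpectrum (𝓞 K))
  {S : Set (HeightOneSpectrum (𝓞 K))} (γ : Field.absoluteGaloisGroup K) [Fact (κ.IsTopGenerator γ)]

/-- **Erratum p. 4 read ONE-SIDEDLY on `X^Σ = X_ac^Σ(E[p^∞])`, WITHOUT Lemma 2.2.** Inputs: `Σ` finite;
`X^Σ` is `Λ`-TORSION [CTL] — and nothing else about `X^Σ`; member modules `N_m` with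
`Λ`-isomorphisms `X^Σ/p^m ≅ N_m/p^m` [(b)+Lemma 2.1], the printed member inclusions `N_m torsion →
Ch(N_m)·R₀⟦T⟧ ⊆ (L_m)` [(2.5)_m], `(L_m) + (p^m) = (L^Σ) + (p^m)` [(c)]; one-sided `Σ`-removal data
`P_Σ ≠ 0`, `Ch(X^∅)·(P_Σ) ⊆ Ch(X^Σ)`, `(L^Σ) = (L·φP_Σ)`. Output: `Ch_Λ(X^∅)·R₀⟦T⟧ ⊆ (L)`. Proof: X2's
two-ring Krull limit gives `Fitt_Λ(X^Σ)·R₀⟦T⟧ ⊆ (L^Σ)`; the finite-submodule bounds `(p)^a·Ch(X^Σ) ⊆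
Fitt₀(X^Σ)` (bsd-eis) and `(T)^b·Ch(X^Σ) ⊆ Fitt₀(X^Σ)` (§1) give `p^a·F, T^b·F ∈ (L^Σ)R₀⟦T⟧` for a
generator `F` of `Ch(X^Σ)`; `Σ`-removal at the level of elements; two-prime cancellation in the UFD
`R₀⟦T⟧` (`p`, `T` non-associated primes). CONDITIONAL on the displayed inputs; no `hnf`, no `μ = 0`.
[cite: Castella2018Erratum, proof of Thm. 1.1 (p. 4), read one-sidedly]
[cite: Skinner2016PacificMC, §3.1 (p. 192)] [cite: Washington1997, §13.2] -/
theorem AcSelmer.XAc.charIdeal_map_toUnr_le_span_of_oneSided_congruences_of_isTorsion (hS : S.Finite)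
    (hT : Module.IsTorsion (IwasawaAlgebra p) (XAc E p κ 𝔭 S γ))
    (N : ℕ → Type) [∀ m, AddCommGroup (N m)] [∀ m, Module (IwasawaAlgebra p) (N m)]
    [∀ m, Module.Finite (IwasawaAlgebra p) (N m)] (LS : UnrSeries p) (Lm : ℕ → UnrSeries p)
    (e : ∀ m : ℕ, 1 ≤ m →
      ((XAc E p κ 𝔭 S γ ⧸ ((Ideal.span {(PowerSeries.C (p : ℤ_[p]) : IwasawaAlgebra p)}) ^ m •
          (⊤ : Submodule (IwasawaAlgebra p) (XAc E p κ 𝔭 S γ)))) ≃ₗ[IwasawaAlgebra p]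
        (N m ⧸ ((Ideal.span {(PowerSeries.C (p : ℤ_[p]) : IwasawaAlgebra p)}) ^ m •
          (⊤ : Submodule (IwasawaAlgebra p) (N m))))))
    (hF : ∀ m : ℕ, 1 ≤ m → Module.IsTorsion (IwasawaAlgebra p) (N m) →
      (Module.charIdeal (IwasawaAlgebra p) (N m)).map (PowerSeries.map (toUnr p)) ≤
        Ideal.span {Lm m})
    (hc : ∀ m : ℕ, 1 ≤ m →
      Ideal.span {Lm m} ⊔ (Ideal.span {(PowerSeries.C ((p : ℕ) : unrIntegers p) : UnrSeries p)}) ^ m =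
        Ideal.span {LS} ⊔ (Ideal.span {(PowerSeries.C ((p : ℕ) : unrIntegers p) : UnrSeries p)}) ^ m)
    {PS : IwasawaAlgebra p} (hPS : PS ≠ 0)
    (hX : XAc.charIdeal E p κ 𝔭 ∅ γ * Ideal.span {PS} ≤ XAc.charIdeal E p κ 𝔭 S γ)
    {L : UnrSeries p} (hLS : Ideal.span {LS} = Ideal.span {L * PowerSeries.map (toUnr p) PS}) :
    (XAc.charIdeal E p κ 𝔭 ∅ γ).map (PowerSeries.map (toUnr p)) ≤ Ideal.span {L} := by
  set φ : IwasawaAlgebra p →+* UnrSeries p := PowerSeries.map (toUnr p) with hφ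
  haveI : Module.Finite (IwasawaAlgebra p) (XAc E p κ 𝔭 S γ) := XAc.module_finite κ 𝔭 S γ hS
  haveI := HidaLimitAlgebra.isNoetherianRing_unrSeries (p := p)
  haveI := HidaLimitAlgebra.isDiscreteValuationRing_unrIntegers (p := p)
  -- (1) the two-ring one-sided limit on the ORDER ideal (no `hnf` here)
  have hI : (Ideal.span {(PowerSeries.C (p : ℤ_[p]) : IwasawaAlgebra p)}).map φ ≤
      (⊥ : Ideal (UnrSeries p)).jacobson := by
    rw [hφ, HidaLimitAlgebra.map_span_C_p]
    exact HidaLimitAlgebra.span_C_p_le_jacobson_unrSeries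
  have hc' : ∀ m : ℕ, 1 ≤ m → Ideal.span {Lm m} ⊔
      ((Ideal.span {(PowerSeries.C (p : ℤ_[p]) : IwasawaAlgebra p)}).map φ) ^ m = Ideal.span {LS} ⊔
      ((Ideal.span {(PowerSeries.C (p : ℤ_[p]) : IwasawaAlgebra p)}).map φ) ^ m := by
    intro m hm
    rw [hφ, HidaLimitAlgebra.map_span_C_p]
    exact hc m hm
  have hF' : ∀ m : ℕ, 1 ≤ m →
      (Module.fittingIdeal (IwasawaAlgebra p) (N m) 0).map φ ≤ Ideal.span {Lm m} := by
    intro m hm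
    by_cases hNt : Module.IsTorsion (IwasawaAlgebra p) (N m)
    · exact HidaLimitAlgebra.map_fittingIdeal_le_of_map_charIdeal_le _ hNt (hF m hm hNt)
    · have h0 : Module.fittingIdeal (IwasawaAlgebra p) (N m) 0 = ⊥ :=
        le_bot_iff.mp (Module.fittingIdeal_zero_le_annihilator.trans
          (Module.annihilator_eq_bot_of_not_isTorsion hNt).le)
      rw [h0, Ideal.map_bot]
      exact bot_le
  have key : (Module.fittingIdeal (IwasawaAlgebra p) (XAc E p κ 𝔭 S γ) 0).map φ ≤ Ideal.span {LS} :=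
    HidaLimitAlgebra.map_le_span_of_oneSided_congruences φ
      (Ideal.span {(PowerSeries.C (p : ℤ_[p]) : IwasawaAlgebra p)}) N hI
      (le_refl (Module.fittingIdeal (IwasawaAlgebra p) (XAc E p κ 𝔭 S γ) 0)) LS Lm e hF' hc'
  -- (2) generators of the two characteristic ideals
  obtain ⟨F, hFS⟩ := (charIdeal_isPrincipal_holds p (XAc E p κ 𝔭 S γ)).principal
  obtain ⟨G, hG0⟩ := (charIdeal_isPrincipal_holds p (XAc E p κ 𝔭 ∅ γ)).principal
  have hFS1 : Module.charIdeal (IwasawaAlgebra p) (XAc E p κ 𝔭 S γ) = Ideal.span {F} := hFS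
  have hG1 : XAc.charIdeal E p κ 𝔭 ∅ γ = Ideal.span {G} := hG0
  have hFS2 : XAc.charIdeal E p κ 𝔭 S γ = Ideal.span {F} := hFS
  -- (3) `p^a·F` and `T^b·F` lie in `Fitt₀(X^Σ)`, hence their images lie in `(L^Σ)`
  obtain ⟨a, ha⟩ := exists_span_C_pow_mul_span_le_fittingIdeal_zero (XAc E p κ 𝔭 S γ) hT hFS1
  obtain ⟨b, hb⟩ :=
    CongruenceDescent.exists_span_X_pow_mul_span_le_fittingIdeal_zero (XAc E p κ 𝔭 S γ) hT hFS1
  have memS : ∀ {x : IwasawaAlgebra p} {n : ℕ},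
      Ideal.span {x} ^ n * Ideal.span {F} ≤ Module.fittingIdeal (IwasawaAlgebra p) (XAc E p κ 𝔭 S γ) 0 →
        LS ∣ φ x ^ n * φ F := by
    intro x n hle
    have hmem : x ^ n * F ∈ Ideal.span {x} ^ n * Ideal.span {F} := by
      rw [Ideal.span_singleton_pow]
      exact Ideal.mul_mem_mul (Ideal.mem_span_singleton_self _) (Ideal.mem_span_singleton_self _)
    have h := key (Ideal.mem_map_of_mem φ (hle hmem))
    rw [map_mul, map_pow] at h
    exact Ideal.mem_span_singleton.mp h
  have hpa : LS ∣ (C ((p : ℕ) : unrIntegers p) : UnrSeries p) ^ a * φ F := by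
    have h := memS ha
    rwa [hφ, PowerSeries.map_C, map_natCast] at h
  have hTb : LS ∣ (X : UnrSeries p) ^ b * φ F := by
    have h := memS hb
    rwa [hφ, PowerSeries.map_X] at h
  -- (4) Σ-removal at the level of elements: `L ∣ p^a·φG`, `L ∣ T^b·φG`
  have hFG : φ F ∣ φ G * φ PS := by
    rw [← map_mul]
    refine map_dvd φ (Ideal.mem_span_singleton.mp ?_)
    rw [← hFS2]
    refine hX ?_
    rw [hG1]
    exact Ideal.mul_mem_mul (Ideal.mem_span_singleton_self G) (Ideal.mem_span_singleton_self PS)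
  have hPS' : φ PS ≠ 0 := fun h ↦ hPS (map_toUnr_injective (by rw [← hφ, h, map_zero]))
  have hLSass : L * φ PS ∣ LS := (Ideal.span_singleton_eq_span_singleton.mp hLS).symm.dvd
  have cancel : ∀ {y : UnrSeries p}, LS ∣ y * φ F → L ∣ y * φ G := by
    intro y hy
    have h : L * φ PS ∣ y * φ G * φ PS :=
      calc L * φ PS ∣ LS := hLSass
        _ ∣ y * φ F := hy
        _ ∣ y * (φ G * φ PS) := mul_dvd_mul_left y hFG
        _ = y * φ G * φ PS := (mul_assoc _ _ _).symm
    exact (mul_dvd_mul_iff_right hPS').mp h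
  have hL1 : L ∣ (C ((p : ℕ) : unrIntegers p) : UnrSeries p) ^ a * φ G := cancel hpa
  have hL2 : L ∣ (X : UnrSeries p) ^ b * φ G := cancel hTb
  -- (5) two-prime cancellation in the UFD `R₀⟦T⟧`
  have hLG : L ∣ φ G :=
    CongruenceDescent.dvd_of_dvd_prime_pow_mul_of_dvd_prime_pow_mul
      (prime_C_of_prime CongruenceDescent.prime_natCast_p_unrIntegers)
      CongruenceDescent.not_C_p_dvd_X_unrSeries a b L (φ G) hL1 hL2
  -- (6) conclusion
  rw [hG1, Ideal.map_span, Set.image_singleton]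
  exact Ideal.span_singleton_le_span_singleton.mpr hLG

end XAc

end Summit.BirchSwinnertonDyer.Rank1Residual.X11b

end
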